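import Summits.Ventures.PercRepro.S1TriangleCoverNullity

/-!
# PercRepro — THE TRIANGLES OF A `(10, 17)` CORE DO NOT COVER THE GROUND SET (p2, gen 25; SUBCLAIM-S1 §6.9 (x))

On a coloop-free `e`-free core of nullity `7` with `17` points and at least `9` triangles, some point lies on no
triangle. The proof is pure counting with the restriction cap `cq3` (`0, 1, 2, 4, 5, 7, 10, 11, …`) and the
triangle lever `#{T ⊆ S} ≤ ⌊|S|·cq3 (ν − 1)/(|S| − 3)⌋` (S1ChainRestrict): `s₃ ≤ cq3 7 = 11`, so
`Σ_x deg x = 3·s₃ ≤ 33 < 34` gives a point `z` of degree `1` (if every point were covered) with triangle `T`; the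
union `S′` of the triangles avoiding `z` contains the `14` points outside `T`, has nullity exactly `6`
(`≤ 6` as `z ∉ S′`, `≥ 6` as it holds `s₃ − 1 ≥ 8 > cq3 5` triangles), and the lever reads
`s₃ − 1 ≤ ⌊7·|S′|/(|S′| − 3)⌋ = 8`, so `s₃ = 9`. Then at least `34 − 27 = 7` points have degree `1`, one of them,
`z′`, outside `T`, with triangle `T′ ∌ z`; the union `S″` of the triangles avoiding `z` and `z′` contains the
`≥ 11` points outside `T ∪ T′`, has nullity `5` (`≤ 5` inside `E ∖ {z, z′}`, `≥ 5` as it holds `7 > cq3 4`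
triangles), and the lever reads `7 ≤ ⌊5·|S″|/(|S″| − 3)⌋ ≤ 6` — contradiction.

* `ncard_triangles_le_eleven` — `s₃ ≤ 11` at nullity `7`;
* `triangle_union_facts` — the union of the triangles avoiding a set `Z`: inside `E ∖ Z`, covered by its own
  triangles, and holding exactly the triangles avoiding `Z`;
* **`exists_notMem_triangles_of_nine`** — the theorem.
Axioms: standard.
-/

open scoped Matroid

namespace PercRepro

namespace S1

open Set

variable {α : Type}

/-- **`s₃ ≤ 11` at nullity `7`** on the `e`-free core (the restriction cap `cq3 7 = 11` on `E` itself). -/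
theorem ncard_triangles_le_eleven (M : Matroid α) [M.Finite]
    (hfree : ∀ e ∈ M.E, ∃ A ⊆ M.E \ {e}, e ∉ M.closure A ∧ e ∉ M.closure ((M.E \ {e}) \ A))
    (hd : M.E.encard = M.eRank + ((7 : ℕ) : ℕ∞)) :
    {C : Set α | M.IsCircuit C ∧ C.ncard = 3}.ncard ≤ 11 := by
  have h := ncard_triangles_subset_le_cq3 M hfree (S := M.E) subset_rfl (ν := 7) (by rwa [M.eRk_ground])
  have heq : {C : Set α | M.IsCircuit C ∧ C.ncard = 3 ∧ C ⊆ M.E} = {C : Set α | M.IsCircuit C ∧ C.ncard = 3} := by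
    ext C
    simp only [Set.mem_setOf_eq]
    exact ⟨fun h => ⟨h.1, h.2.1⟩, fun h => ⟨h.1, h.2, h.1.subset_ground⟩⟩
  rw [heq] at h
  exact h.trans (by decide)

open Classical in
/-- **The union of the triangles avoiding `Z`**: with `𝒯` the finset of all triangles and
`S := ⋃ {C ∈ 𝒯 : C ∩ Z = ∅}`, the set `S` lies in `E`, misses `Z`, is covered by its own triangles, contains every
triangle avoiding `Z`, and the triangles inside `S` are exactly the members of the filter. -/
theorem triangle_union_facts (M : Matroid α) [M.Finite] (Z : Set α) (S : Set α)
    (hSdef : S = ⋃ C ∈ (finite_triangles M).toFinset.filter (fun C => ∀ x ∈ Z, x ∉ C), C) :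
    S ⊆ M.E ∧ (∀ x ∈ Z, x ∉ S) ∧ (∀ x ∈ S, ∃ C, M.IsCircuit C ∧ C ⊆ S ∧ x ∈ C) ∧
      (∀ C, M.IsCircuit C → C.ncard = 3 → (∀ x ∈ Z, x ∉ C) → C ⊆ S) ∧
      {C : Set α | M.IsCircuit C ∧ C.ncard = 3 ∧ C ⊆ S} =
        (((finite_triangles M).toFinset.filter (fun C => ∀ x ∈ Z, x ∉ C) : Finset (Set α)) : Set (Set α)) := by
  have hmem𝒯 : ∀ C, C ∈ (finite_triangles M).toFinset ↔ M.IsCircuit C ∧ C.ncard = 3 := fun C => by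
    rw [Set.Finite.mem_toFinset]; rfl
  have hsub : ∀ C ∈ (finite_triangles M).toFinset, (∀ x ∈ Z, x ∉ C) → C ⊆ S := by
    intro C hC hCZ
    rw [hSdef]
    exact Set.subset_biUnion_of_mem (u := fun C => C) (Finset.mem_filter.2 ⟨hC, hCZ⟩)
  have hmemS : ∀ y, y ∈ S ↔ ∃ C ∈ (finite_triangles M).toFinset, (∀ x ∈ Z, x ∉ C) ∧ y ∈ C := by
    intro y
    rw [hSdef]
    simp only [Set.mem_iUnion, Finset.mem_filter, exists_prop]
    constructor
    · rintro ⟨C, ⟨hC, hCZ⟩, hy⟩; exact ⟨C, hC, hCZ, hy⟩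
    · rintro ⟨C, hC, hCZ, hy⟩; exact ⟨C, ⟨hC, hCZ⟩, hy⟩
  refine ⟨?_, ?_, ?_, fun C hC h3 hCZ => hsub C ((hmem𝒯 C).2 ⟨hC, h3⟩) hCZ, ?_⟩
  · intro y hy
    obtain ⟨C, hC, -, hyC⟩ := (hmemS y).1 hy
    exact ((hmem𝒯 C).1 hC).1.subset_ground hyC
  · intro x hx hxS
    obtain ⟨C, -, hCZ, hxC⟩ := (hmemS x).1 hxS
    exact hCZ x hx hxC
  · intro y hy
    obtain ⟨C, hC, hCZ, hyC⟩ := (hmemS y).1 hy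
    exact ⟨C, ((hmem𝒯 C).1 hC).1, hsub C hC hCZ, hyC⟩
  · ext C
    simp only [Set.mem_setOf_eq, Finset.coe_filter, hmem𝒯]
    constructor
    · rintro ⟨hC, h3, hCS⟩
      refine ⟨⟨hC, h3⟩, fun x hx hxC => ?_⟩
      obtain ⟨C', -, hC'Z, hxC'⟩ := (hmemS x).1 (hCS hxC)
      exact hC'Z x hx hxC'
    · rintro ⟨⟨hC, h3⟩, hCZ⟩
      exact ⟨hC, h3, hsub C ((hmem𝒯 C).2 ⟨hC, h3⟩) hCZ⟩

open Classical in
/-- **THE TRIANGLES DO NOT COVER A `(10, 17)` CORE WITH `≥ 9` TRIANGLES**: on a coloop-free `e`-free core of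
nullity `7` with `17` points and at least `9` triangles, some point lies on no triangle. -/
theorem exists_notMem_triangles_of_nine (M : Matroid α) [M.Finite]
    (hfree : ∀ e ∈ M.E, ∃ A ⊆ M.E \ {e}, e ∉ M.closure A ∧ e ∉ M.closure ((M.E \ {e}) \ A))
    (hd : M.E.encard = M.eRank + ((7 : ℕ) : ℕ∞)) (hn : M.E.ncard = 17) (hcol : M.coloops = ∅)
    (h9 : 9 ≤ {C : Set α | M.IsCircuit C ∧ C.ncard = 3}.ncard) :
    ∃ x ∈ M.E, ∀ C, M.IsCircuit C → C.ncard = 3 → x ∉ C := by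
  by_contra hcov
  push Not at hcov
  have hEfin : M.E.Finite := M.ground_finite
  have hmem𝒯 : ∀ C, C ∈ (finite_triangles M).toFinset ↔ M.IsCircuit C ∧ C.ncard = 3 := fun C => by
    rw [Set.Finite.mem_toFinset]; rfl
  have h𝒯card : (finite_triangles M).toFinset.card = {C : Set α | M.IsCircuit C ∧ C.ncard = 3}.ncard :=
    (Set.ncard_eq_toFinset_card _ (finite_triangles M)).symm
  have hs11 : {C : Set α | M.IsCircuit C ∧ C.ncard = 3}.ncard ≤ 11 := ncard_triangles_le_eleven M hfree hd
  have hEcard : hEfin.toFinset.card = 17 := by rw [← Set.ncard_eq_toFinset_card _ hEfin, hn]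
  have hmemE : ∀ x, x ∈ hEfin.toFinset ↔ x ∈ M.E := fun x => Set.Finite.mem_toFinset _
  -- the degrees sum to `3·s₃`
  have hsum : ∑ x ∈ hEfin.toFinset, ((finite_triangles M).toFinset.filter (fun C => x ∈ C)).card =
      3 * (finite_triangles M).toFinset.card :=
    sum_card_filter_mem M _ 3 (fun C hC => ⟨((hmem𝒯 C).1 hC).1.subset_ground, ((hmem𝒯 C).1 hC).2⟩)
  -- every point has degree `≥ 1`
  have hdeg1 : ∀ x ∈ hEfin.toFinset, 1 ≤ ((finite_triangles M).toFinset.filter (fun C => x ∈ C)).card := by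
    intro x hx
    obtain ⟨C, hC, h3, hxC⟩ := hcov x ((hmemE x).1 hx)
    exact Finset.card_pos.2 ⟨C, Finset.mem_filter.2 ⟨(hmem𝒯 C).2 ⟨hC, h3⟩, hxC⟩⟩
  -- a point of degree `1`
  have hz : ∃ z ∈ hEfin.toFinset, ((finite_triangles M).toFinset.filter (fun C => z ∈ C)).card = 1 := by
    by_contra hne
    push Not at hne
    have h2 : ∀ x ∈ hEfin.toFinset, 2 ≤ ((finite_triangles M).toFinset.filter (fun C => x ∈ C)).card := by
      intro x hx
      have := hdeg1 x hx
      have := hne x hx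
      omega
    have := Finset.card_nsmul_le_sum hEfin.toFinset
      (fun x => ((finite_triangles M).toFinset.filter (fun C => x ∈ C)).card) 2 h2
    rw [hsum, hEcard, smul_eq_mul] at this
    omega
  obtain ⟨z, hzE', hdegz⟩ := hz
  have hzE : z ∈ M.E := (hmemE z).1 hzE'
  obtain ⟨T, hT⟩ := Finset.card_eq_one.1 hdegz
  have hTmem : T ∈ (finite_triangles M).toFinset ∧ z ∈ T := by
    have := Finset.mem_singleton_self T
    rw [← hT] at this
    exact Finset.mem_filter.1 this
  have hT3 := (hmem𝒯 T).1 hTmem.1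
  have hTE : T ⊆ M.E := hT3.1.subset_ground
  have huniq : ∀ C, M.IsCircuit C → C.ncard = 3 → z ∈ C → C = T := by
    intro C hC h3 hzC
    have : C ∈ (finite_triangles M).toFinset.filter (fun C => z ∈ C) :=
      Finset.mem_filter.2 ⟨(hmem𝒯 C).2 ⟨hC, h3⟩, hzC⟩
    rw [hT] at this
    exact Finset.mem_singleton.1 this
  -- the union `S′` of the triangles avoiding `z`
  obtain ⟨hS'E, hzS', hcov', hsub', heq'⟩ :=
    triangle_union_facts M {z} (⋃ C ∈ (finite_triangles M).toFinset.filter (fun C => ∀ x ∈ ({z} : Set α), x ∉ C), C) rfl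
  set S' := ⋃ C ∈ (finite_triangles M).toFinset.filter (fun C => ∀ x ∈ ({z} : Set α), x ∉ C), C with hS'def
  have hzS'' : z ∉ S' := hzS' z (Set.mem_singleton z)
  have hS'fin : S'.Finite := hEfin.subset hS'E
  -- the triangles inside `S′` number `s₃ − 1`
  have hS'tri : {C : Set α | M.IsCircuit C ∧ C.ncard = 3 ∧ C ⊆ S'}.ncard = (finite_triangles M).toFinset.card - 1 := by
    rw [heq', Set.ncard_coe_finset]
    have hfilt : (finite_triangles M).toFinset.filter (fun C => ∀ x ∈ ({z} : Set α), x ∉ C) =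
        (finite_triangles M).toFinset.filter (fun C => ¬ z ∈ C) := by
      apply Finset.filter_congr
      intro C _
      simp only [Set.mem_singleton_iff, forall_eq]
    rw [hfilt]
    have := Finset.card_filter_add_card_filter_not (s := (finite_triangles M).toFinset) (fun C => z ∈ C)
    rw [hdegz] at this
    omega
  -- the nullity of `S′` is exactly `6`
  obtain ⟨ν', hν'⟩ := exists_nullity M hS'E
  have hν'le : ν' + 1 ≤ 7 := by
    refine nullity_add_one_le_of_ssubset_of_coloops_empty M hcol hd hS'E (fun h => hzS'' (h ▸ hzE)) ?_
    rw [hS'fin.cast_ncard_eq, hν']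
  have htri_le := ncard_triangles_subset_le_cq3 M hfree hS'E hν'
  rw [hS'tri, h𝒯card] at htri_le
  have hν'eq : ν' = 6 := by
    have hcq : ν' ≤ 5 → TriangleCap.cq3 ν' ≤ 7 := by
      intro h
      interval_cases ν' <;> decide
    by_contra hne
    have := hcq (by omega)
    omega
  -- `S′` contains the `14` points outside `T`
  have hET : M.E \ T ⊆ S' := by
    intro w hw
    obtain ⟨C, hC, h3, hwC⟩ := hcov w hw.1
    have hzC : z ∉ C := fun hzC => hw.2 (huniq C hC h3 hzC ▸ hwC)
    exact hsub' C hC h3 (fun x hx => by rw [Set.mem_singleton_iff] at hx; rw [hx]; exact hzC) hwC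
  have hS'ge : 14 ≤ S'.ncard := by
    have h1 : (M.E \ T).ncard ≤ S'.ncard := Set.ncard_le_ncard hET hS'fin
    have h2 : (M.E \ T).ncard = M.E.ncard - T.ncard := Set.ncard_sdiff hTE (hEfin.subset hTE)
    rw [h2, hn, hT3.2] at h1
    omega
  have hS'le : S'.ncard ≤ 16 := by
    have h1 : S' ⊆ M.E \ {z} := fun y hy => ⟨hS'E hy, fun h => hzS'' (by rw [Set.mem_singleton_iff] at h; rw [← h]; exact hy)⟩
    have h2 : (M.E \ {z}).ncard = M.E.ncard - 1 := Set.ncard_sdiff_singleton_of_mem hzE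
    have := Set.ncard_le_ncard h1 (hEfin.subset sdiff_subset)
    omega
  -- the lever on `S′`: `s₃ − 1 ≤ ⌊7·|S′|/(|S′| − 3)⌋ = 8`
  have hlever := ncard_triangles_subset_le_lever M hfree hS'E hcov' (ν := 5) (by rw [hν', hν'eq]) (by omega)
  rw [hS'tri, h𝒯card] at hlever
  have hcq5 : TriangleCap.cq3 5 = 7 := by decide
  rw [hcq5] at hlever
  have hs9 : {C : Set α | M.IsCircuit C ∧ C.ncard = 3}.ncard = 9 := by
    obtain ⟨m, hm⟩ : ∃ m, S'.ncard = m := ⟨_, rfl⟩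
    rw [hm] at hlever hS'ge hS'le
    have : m * 7 / (m - 3) ≤ 8 := by interval_cases m <;> decide
    omega
  -- `s₃ = 9`: at least `7` points of degree `1`, one of them outside `T`
  have hsum9 : ∑ x ∈ hEfin.toFinset, ((finite_triangles M).toFinset.filter (fun C => x ∈ C)).card = 27 := by
    rw [hsum, h𝒯card, hs9]
  have hD₁card : 7 ≤ (hEfin.toFinset.filter
      (fun x => ((finite_triangles M).toFinset.filter (fun C => x ∈ C)).card = 1)).card := by
    have hsplit := Finset.sum_filter_add_sum_filter_not hEfin.toFinset
      (fun x => ((finite_triangles M).toFinset.filter (fun C => x ∈ C)).card = 1)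
      (fun x => ((finite_triangles M).toFinset.filter (fun C => x ∈ C)).card)
    rw [hsum9] at hsplit
    have hA : (hEfin.toFinset.filter
        (fun x => ((finite_triangles M).toFinset.filter (fun C => x ∈ C)).card = 1)).card • 1 ≤
        ∑ x ∈ hEfin.toFinset.filter (fun x => ((finite_triangles M).toFinset.filter (fun C => x ∈ C)).card = 1),
          ((finite_triangles M).toFinset.filter (fun C => x ∈ C)).card :=
      Finset.card_nsmul_le_sum _ _ _ (fun x hx => hdeg1 x (Finset.mem_filter.1 hx).1)
    have hB : (hEfin.toFinset.filter (fun x => ¬ ((finite_triangles M).toFinset.filter (fun C => x ∈ C)).card = 1)).card • 2 ≤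
        ∑ x ∈ hEfin.toFinset.filter (fun x => ¬ ((finite_triangles M).toFinset.filter (fun C => x ∈ C)).card = 1),
          ((finite_triangles M).toFinset.filter (fun C => x ∈ C)).card := by
      apply Finset.card_nsmul_le_sum
      intro x hx
      have h1 := hdeg1 x (Finset.mem_filter.1 hx).1
      have h2 := (Finset.mem_filter.1 hx).2
      omega
    have hcards := Finset.card_filter_add_card_filter_not (s := hEfin.toFinset)
      (fun x => ((finite_triangles M).toFinset.filter (fun C => x ∈ C)).card = 1)
    rw [hEcard] at hcards
    rw [smul_eq_mul] at hA hB
    omega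
  have hz' : ∃ z' ∈ hEfin.toFinset.filter
      (fun x => ((finite_triangles M).toFinset.filter (fun C => x ∈ C)).card = 1), z' ∉ T := by
    by_contra hall
    push Not at hall
    have hTfin : T.Finite := hEfin.subset hTE
    have hsub : hEfin.toFinset.filter
        (fun x => ((finite_triangles M).toFinset.filter (fun C => x ∈ C)).card = 1) ⊆ hTfin.toFinset :=
      fun x hx => (Set.Finite.mem_toFinset hTfin).2 (hall x hx)
    have := Finset.card_le_card hsub
    rw [← Set.ncard_eq_toFinset_card _ hTfin, hT3.2] at this
    omega
  obtain ⟨z', hz'D, hz'T⟩ := hz'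
  have hz'E : z' ∈ M.E := (hmemE z').1 (Finset.mem_filter.1 hz'D).1
  have hdegz' : ((finite_triangles M).toFinset.filter (fun C => z' ∈ C)).card = 1 := (Finset.mem_filter.1 hz'D).2
  obtain ⟨T', hT'⟩ := Finset.card_eq_one.1 hdegz'
  have hT'mem : T' ∈ (finite_triangles M).toFinset ∧ z' ∈ T' := by
    have := Finset.mem_singleton_self T'
    rw [← hT'] at this
    exact Finset.mem_filter.1 this
  have hT'3 := (hmem𝒯 T').1 hT'mem.1
  have hT'E : T' ⊆ M.E := hT'3.1.subset_ground
  have huniq' : ∀ C, M.IsCircuit C → C.ncard = 3 → z' ∈ C → C = T' := by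
    intro C hC h3 hz'C
    have : C ∈ (finite_triangles M).toFinset.filter (fun C => z' ∈ C) :=
      Finset.mem_filter.2 ⟨(hmem𝒯 C).2 ⟨hC, h3⟩, hz'C⟩
    rw [hT'] at this
    exact Finset.mem_singleton.1 this
  have hzT' : z ∉ T' := fun h => hz'T (huniq T' hT'3.1 hT'3.2 h ▸ hT'mem.2)
  have hzz' : z ≠ z' := fun h => hz'T (h ▸ hTmem.2)
  -- the union `S″` of the triangles avoiding `z` and `z′`
  obtain ⟨hS''E, hZS'', hcov'', hsub'', heq''⟩ :=
    triangle_union_facts M {z, z'}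
      (⋃ C ∈ (finite_triangles M).toFinset.filter (fun C => ∀ x ∈ ({z, z'} : Set α), x ∉ C), C) rfl
  set S'' := ⋃ C ∈ (finite_triangles M).toFinset.filter (fun C => ∀ x ∈ ({z, z'} : Set α), x ∉ C), C with hS''def
  have hS''fin : S''.Finite := hEfin.subset hS''E
  have hzS'' : z ∉ S'' := hZS'' z (by simp)
  have hz'S'' : z' ∉ S'' := hZS'' z' (by simp)
  -- `S″` holds at least `7` triangles
  have hS''tri : 7 ≤ {C : Set α | M.IsCircuit C ∧ C.ncard = 3 ∧ C ⊆ S''}.ncard := by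
    rw [heq'', Set.ncard_coe_finset]
    have hcards := Finset.card_filter_add_card_filter_not (s := (finite_triangles M).toFinset)
      (fun C => ∀ x ∈ ({z, z'} : Set α), x ∉ C)
    have hle : ((finite_triangles M).toFinset.filter
        (fun C => ¬ ∀ x ∈ ({z, z'} : Set α), x ∉ C)).card ≤ 2 := by
      have hsub : (finite_triangles M).toFinset.filter (fun C => ¬ ∀ x ∈ ({z, z'} : Set α), x ∉ C) ⊆ {T, T'} := by
        intro C hC
        obtain ⟨hC𝒯, hnot⟩ := Finset.mem_filter.1 hC
        have hC3 := (hmem𝒯 C).1 hC𝒯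
        rw [Finset.mem_insert, Finset.mem_singleton]
        by_contra hne
        push Not at hne
        apply hnot
        intro x hx hxC
        rcases hx with rfl | rfl
        · exact hne.1 (huniq C hC3.1 hC3.2 hxC)
        · exact hne.2 (huniq' C hC3.1 hC3.2 hxC)
      exact (Finset.card_le_card hsub).trans (Finset.card_le_two)
    rw [h𝒯card, hs9] at hcards
    omega
  -- the nullity of `S″` is at most `5` (inside `E ∖ {z, z′}`) …
  obtain ⟨ν'', hν''⟩ := exists_nullity M hS''E
  have hX : (M.E \ {z, z'}).encard = M.eRk (M.E \ {z, z'}) + ((7 - 2 : ℕ) : ℕ∞) := by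
    refine nullity_of_subset_closure M sdiff_subset subset_rfl ?_ (by rwa [M.eRk_ground]) ?_
    · intro y hy
      by_cases hyz : y = z
      · rw [hyz]
        refine M.closure_subset_closure ?_ (hT3.1.mem_closure_sdiff_singleton_of_mem hTmem.2)
        intro x hx
        refine ⟨hTE hx.1, ?_⟩
        intro hx'
        rcases hx' with rfl | rfl
        · exact hx.2 rfl
        · exact hz'T hx.1
      by_cases hyz' : y = z'
      · rw [hyz']
        refine M.closure_subset_closure ?_ (hT'3.1.mem_closure_sdiff_singleton_of_mem hT'mem.2)
        intro x hx
        refine ⟨hT'E hx.1, ?_⟩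
        intro hx'
        rcases hx' with rfl | rfl
        · exact hzT' hx.1
        · exact hx.2 rfl
      · exact M.subset_closure _ sdiff_subset ⟨hy, by simp [hyz, hyz']⟩
    · rw [Set.sdiff_sdiff_cancel_left (by intro x hx; rcases hx with rfl | rfl <;> assumption), Set.encard_pair hzz']
      rfl
  have hν''le : ν'' ≤ 7 - 2 :=
    nullity_le_of_subset M (T := M.E \ {z, z'}) (fun y hy => ⟨hS''E hy, fun h => by
      rcases h with rfl | rfl
      · exact hzS'' hy
      · exact hz'S'' hy⟩) sdiff_subset hν'' hX
  -- … and at least `5` (it holds `7 > cq3 4` triangles), hence exactly `5`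
  have htri_le'' := ncard_triangles_subset_le_cq3 M hfree hS''E hν''
  have hν''eq : ν'' = 5 := by
    have hcq : ν'' ≤ 4 → TriangleCap.cq3 ν'' ≤ 5 := by
      intro h
      interval_cases ν'' <;> decide
    by_contra hne
    have := hcq (by omega)
    omega
  -- `S″` contains the `≥ 11` points outside `T ∪ T′`
  have hETT : M.E \ (T ∪ T') ⊆ S'' := by
    intro w hw
    obtain ⟨C, hC, h3, hwC⟩ := hcov w hw.1
    have hzC : z ∉ C := fun hzC => hw.2 (Or.inl (huniq C hC h3 hzC ▸ hwC))
    have hz'C : z' ∉ C := fun hz'C => hw.2 (Or.inr (huniq' C hC h3 hz'C ▸ hwC))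
    refine hsub'' C hC h3 (fun x hx => ?_) hwC
    rcases hx with rfl | rfl
    · exact hzC
    · exact hz'C
  have hS''ge : 11 ≤ S''.ncard := by
    have h1 : (M.E \ (T ∪ T')).ncard ≤ S''.ncard := Set.ncard_le_ncard hETT hS''fin
    have h2 : M.E.ncard ≤ (M.E \ (T ∪ T')).ncard + (T ∪ T').ncard :=
      Set.ncard_le_ncard_sdiff_add_ncard M.E (T ∪ T') (hEfin.subset (Set.union_subset hTE hT'E))
    have h3 : (T ∪ T').ncard ≤ T.ncard + T'.ncard := Set.ncard_union_le T T'
    rw [hn] at h2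
    rw [hT3.2, hT'3.2] at h3
    omega
  have hS''le : S''.ncard ≤ 17 := by
    have := Set.ncard_le_ncard hS''E hEfin
    omega
  -- the lever on `S″`: `7 ≤ ⌊5·|S″|/(|S″| − 3)⌋ ≤ 6`
  have hlever'' := ncard_triangles_subset_le_lever M hfree hS''E hcov'' (ν := 4) (by rw [hν'', hν''eq]) (by omega)
  have hcq4 : TriangleCap.cq3 4 = 5 := by decide
  rw [hcq4] at hlever''
  obtain ⟨m, hm⟩ : ∃ m, S''.ncard = m := ⟨_, rfl⟩
  rw [hm] at hlever'' hS''ge hS''le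
  have : m * 5 / (m - 3) ≤ 6 := by interval_cases m <;> decide
  omega

end S1

end PercRepro
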